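import Summits.ResolutionOfSingularities.ResolutionOfSingularities.Theorems.EquisingularLiftEquisingularLiftNatMemberSAtStepRegular
import HarnessLib

/-!
# [OURS · L1 W4.5(b) · EL♮(3) · WIDTH TABLE D4 «HOSTED NOSE» brick D4-3 (HT1)] A HOST DIVISOR THROUGH A NESTED-SECTION POINT STEP

Desk WIDTH TABLE D4 v0 (2026-08-28), brick D4-3 (res-L1-w45b-stub-4 g11): the first of the two host-transport lemmas for res-L1-w45b-stub-2's engine K5ʰ
(state `(X, σ, S, j, T, 𝓔)` with a HOST divisor `𝓔`).  `--supports stmt-ResolutionOfSingularities-20148`, no claim, counted 0.  AI-produced; NOT a statement of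
[Hironaka2017]; EL♮(3) is NOT proved here.

WHAT.
* `comap_strictTransformIdeal_host_eq_of_nestedSection` — the SINGLE-divisor form of `comap_strictTransformIdeal_carrier_eq_of_regularPoint`
  (✓ `…NatCarrierExactPointSteps`): in K5′'s point-step model square (section `s` through `j x`, `τ = Bl_{ker s}`, `υ = Bl_x`, `j₂ ≫ τ = υ ≫ j`), for an ideal
  sheaf `𝓔 ≤ ker s` (the section NESTED in the host) whose stalk at `j x` is generated by an element outside `𝔪²`:
  `(St_τ 𝓔)·𝒪_{F₂} = St_υ (𝓔·𝒪_{F₁})` (section frame `exists_sectionFrame_forall_dim_at`, linear form `exists_linearForm_conePack`, F⁺5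
  `comap_strictTransformIdeal_eq_of_model` — res-type-027 / res-L1-w45b-stub-1 kit).
* ★ `hostClauses_strictTransform_of_nestedSection` — the host clauses «`V(𝓔)` regular, stalkwise principal, `O`-flat, `≠ ⊥`, reduced special-fibre trace
  `𝓘⟨E⟩`» PERSIST for `St_τ 𝓔` at the new stage `(X₁, τ ≫ σ)` with trace `𝓘⟨closure (υ⁻¹(E ∖ {x}))⟩`: regular + principal = res-type-027's
  `member_clause_iii_strictTransform_section` (pair `(𝓔, 𝓔)`), flat = res-L1-w45b-stub-2's `flat_strictTransform_subschemeι_comp_stage`, trace = the lemma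
  above + `strictTransformIdeal_vanishingIdeal_eq` (the host's equation at `j x` has order one because `V(𝓔)` is regular there,
  `exists_generator_not_mem_sq_of_isRegular_subscheme`).
(HT2) — the host through a NEST round — is a separate file.
-/

set_option linter.dupNamespace false
set_option linter.overlappingInstances false

noncomputable section

open CategoryTheory CategoryTheory.Limits AlgebraicGeometry TopologicalSpace Topology IsLocalRing
open Literature.AlgebraicGeometry.Resolution
open AlgebraicGeometry.Scheme.IdealSheafData
open Summit.ResolutionOfSingularities.ResolutionOfSingularities.Theses.EquisingularLift.Split
open Summit.ResolutionOfSingularities.ResolutionOfSingularities.Cruxes.EquisingularLift.StrataSplit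

namespace Summit.ResolutionOfSingularities.ResolutionOfSingularities.Cruxes.EquisingularLiftNat.Sections

section HostPointStep

variable (O : Type) [CommRing O] [IsDomain O] [IsDiscreteValuationRing O] (k : Type) [Field k] (θ : O →+* k)

/-- **Exactness of ONE host divisor along a nested-section point step** (the single-divisor form of
`comap_strictTransformIdeal_carrier_eq_of_regularPoint`: same model square, same section frame, the linear form of the host's ORDER-ONE equation).
In the model square of the section blow-up `τ` of `ker s` over the point blow-up `υ` of `x`, for an ideal sheaf `𝓔 ≤ ker s` (the section NESTED in the
host) whose stalk at `j x` is generated by an element outside `𝔪²`: `(St_τ 𝓔)·𝒪_{F₂} = St_υ (𝓔·𝒪_{F₁})`.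
[cite: GortzWedhorn2020, Prop. 13.91] [cite: Matsumura1987, Thm. 14.2] [OURS · L1 W4.5b · D4-3 (HT1)] -/
theorem comap_strictTransformIdeal_host_eq_of_nestedSection (hθ : Function.Surjective θ) {X' X₁ F₁ F₂ : Scheme.{0}}
    (r' : X' ⟶ Spec (.of O)) [IsSeparated r'] [IsLocallyNoetherian X₁] [IsLocallyNoetherian F₂] [IsIntegral F₁] [IsIntegral F₂]
    [IsLocallyNoetherian F₁] (j : F₁ ⟶ X') (t : F₁ ⟶ Spec (.of k))
    (hsq : IsPullback j t r' (Spec.map (CommRingCat.ofHom θ)))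
    (s : Spec (.of O) ⟶ X') (hs : s ≫ r' = 𝟙 _) (τ : X₁ ⟶ X') (hτ : IsBlowup τ s.ker)
    (υ : F₂ ⟶ F₁) (j₂ : F₂ ⟶ X₁) (hcomm : j₂ ≫ τ = υ ≫ j) (x : F₁) (hx : IsClosed ({x} : Set F₁))
    (hυ : IsBlowup υ (vanishingIdeal ⟨{x}, hx⟩)) (hJ : s.ker.comap j = vanishingIdeal ⟨{x}, hx⟩)
    (hsx : s (closedPoint O) = j x) (hreg : IsRegularLocalRing (X'.presheaf.stalk (j x))) (ϖ : O) (hϖ : Irreducible ϖ)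
    -- the host
    (𝓔 : X'.IdealSheafData) (hle : 𝓔 ≤ s.ker) {h : X'.presheaf.stalk (j x)} (h𝓔h : stalkIdeal 𝓔 (j x) = Ideal.span {h})
    (hh2 : h ∉ maximalIdeal (X'.presheaf.stalk (j x)) ^ 2) :
    (strictTransformIdeal τ s.ker 𝓔).comap j₂ = strictTransformIdeal υ (vanishingIdeal ⟨{x}, hx⟩) (𝓔.comap j) := by
  classical
  haveI := hreg
  have hϖO : ϖ ∈ maximalIdeal O := by rw [hϖ.maximalIdeal_eq]; exact Ideal.mem_span_singleton_self ϖ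
  -- (1) a section frame at `j x`
  obtain ⟨n, c, θR, hcI, hc, hdom, -, h𝔪, hϖc, -⟩ := exists_sectionFrame_forall_dim_at O r' s hs (j x) hsx hreg ϖ hϖ
  haveI := hdom
  have hc𝔪 : ∀ i, c i ∈ maximalIdeal (X'.presheaf.stalk (j x)) := fun i => by
    rw [← h𝔪]; exact Ideal.mem_sup_left (Ideal.subset_span ⟨i, rfl⟩)
  -- (2) the host's equation lies in the frame ideal
  have h𝓔le : stalkIdeal 𝓔 (j x) ≤ Ideal.span (Set.range c) := hcI ▸ stalkIdeal_mono hle (j x)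
  have hhc : h ∈ Ideal.span (Set.range c) := h𝓔le (h𝓔h ▸ Ideal.mem_span_singleton_self h)
  -- (3) the order-one linear form of the host
  have hg : Ideal.span (Set.range fun i => (j.stalkMap x).hom (c i)) ≠ ⊤ := by
    rw [span_stalkMap_eq_maximalIdeal_of_model θ hθ r' j t hsq x ϖ hϖO c h𝔪]
    exact (maximalIdeal.isMaximal _).ne_top
  obtain ⟨Φh, hΦh1, hΦhev, hΦhc, hΦhbar⟩ := exists_linearForm_conePack c hc𝔪 hhc hh2 (j.stalkMap x).hom hg
  have hcbar : IsQuasiRegular (fun i => (j.stalkMap x).hom (c i)) :=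
    isQuasiRegular_stalkMap_model O k θ hθ r' j t hsq x c hc ϖ hϖ hϖc
  -- (4) F⁺5 for `𝓔`
  exact comap_strictTransformIdeal_eq_of_model τ s.ker 𝓔 hτ j υ j₂ hcomm x hx hυ hJ c hcI hc Φh hΦh1 hΦhc
    (by rw [hΦhev]; exact h𝓔h) hcbar hΦhbar

/-- **(HT1) A HOST divisor through a NESTED-section point step.**  In K5′'s point-step model square at a stage `(X', σ)` over `q` (section `s` through
`j x`, `τ = Bl_{ker s}`, `υ = Bl_x`, `j₂ ≫ τ = υ ≫ j`), a host ideal sheaf `𝓔` with `V(𝓔)` regular, stalkwise principal, `O`-flat, with reduced special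
fibre trace `𝓔·𝒪_{F₁} = 𝓘⟨E⟩`, and CONTAINING the section (`𝓔 ≤ ker s`), steps to `St_τ 𝓔` with THE SAME clauses at the new stage and trace
`𝓘⟨closure (υ⁻¹(E ∖ {x}))⟩`.  Assembly of res-type-027's `member_clause_iii_strictTransform_section` (regular + principal), res-L1-w45b-stub-2's
`flat_strictTransform_subschemeι_comp_stage` (flat) and `comap_strictTransformIdeal_host_eq_of_nestedSection` (trace).
[cite: GortzWedhorn2020, Prop. 13.91] [OURS · L1 W4.5b · WIDTH TABLE D4 brick D4-3 (HT1)] -/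
theorem hostClauses_strictTransform_of_nestedSection (hθ : Function.Surjective θ) {P X' X₁ F₁ F₂ : Scheme.{0}} (σ : X' ⟶ P)
    (q : P ⟶ Spec (.of O)) [IsSeparated (σ ≫ q)] [IsLocallyNoetherian X'] [IsIntegral X'] [IsLocallyNoetherian X₁] [IsLocallyNoetherian F₂]
    [IsIntegral F₁] [IsIntegral F₂] [IsLocallyNoetherian F₁] (hX : Scheme.IsRegular X') (j : F₁ ⟶ X') (t : F₁ ⟶ Spec (.of k))
    (hsq : IsPullback j t (σ ≫ q) (Spec.map (CommRingCat.ofHom θ)))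
    (s : Spec (.of O) ⟶ X') (hs : s ≫ σ ≫ q = 𝟙 _) (τ : X₁ ⟶ X') (hτ : IsBlowup τ s.ker)
    (υ : F₂ ⟶ F₁) (j₂ : F₂ ⟶ X₁) (hcomm : j₂ ≫ τ = υ ≫ j) (x : F₁) (hx : IsClosed ({x} : Set F₁))
    (hυ : IsBlowup υ (vanishingIdeal ⟨{x}, hx⟩)) (hJ : s.ker.comap j = vanishingIdeal ⟨{x}, hx⟩)
    (hsx : s (closedPoint O) = j x)
    -- the host and its clauses
    (𝓔 : X'.IdealSheafData) (hle : 𝓔 ≤ s.ker) (h𝓔0 : 𝓔 ≠ ⊥) (h𝓔reg : Scheme.IsRegular 𝓔.subscheme)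
    (h𝓔pr : ∀ z : X', (stalkIdeal 𝓔 z).IsPrincipal) (h𝓔fl : Flat (𝓔.subschemeι ≫ σ ≫ q))
    (E : Set F₁) (hE : IsClosed E) (h𝓔tr : 𝓔.comap j = vanishingIdeal ⟨E, hE⟩) :
    Scheme.IsRegular (strictTransformIdeal τ s.ker 𝓔).subscheme ∧
    (∀ z : X₁, (stalkIdeal (strictTransformIdeal τ s.ker 𝓔) z).IsPrincipal) ∧
    Flat ((strictTransformIdeal τ s.ker 𝓔).subschemeι ≫ (τ ≫ σ) ≫ q) ∧
    strictTransformIdeal τ s.ker 𝓔 ≠ ⊥ ∧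
    (strictTransformIdeal τ s.ker 𝓔).comap j₂ = vanishingIdeal ⟨closure (υ ⁻¹' (E \ {x})), isClosed_closure⟩ := by
  have hs' : s ≫ (σ ≫ q) = 𝟙 _ := hs
  -- regular + principal + non-zero (027's clause (iii) stepping, the pair `(𝓔, 𝓔)`)
  obtain ⟨⟨hreg', hpr'⟩, hne'⟩ := member_clause_iii_strictTransform_section O (σ ≫ q) s hs' hX hτ 𝓔 𝓔 (by rw [sup_idem]; exact hle) h𝓔0
    ⟨h𝓔reg, fun z => ⟨h𝓔pr z, h𝓔pr z⟩⟩
  refine ⟨hreg', fun z => (hpr' z).1, flat_strictTransform_subschemeι_comp_stage O σ q τ s.ker hτ 𝓔 h𝓔fl, hne', ?_⟩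
  -- the trace: the host's equation at `j x` has order one (`V(𝓔)` regular there), then the single-divisor exactness lemma
  have hxmem : j x ∈ 𝓔.support := by
    have : j x ∈ (s.ker.support : Set X') := by
      have hrange := hJ ▸ (Scheme.IdealSheafData.support_comap s.ker j)
      have hx' : x ∈ ((vanishingIdeal (⟨{x}, hx⟩ : Closeds F₁)).support : Set F₁) := by
        rw [Scheme.IdealSheafData.coe_support_vanishingIdeal]; exact Set.mem_singleton x
      rw [← hJ, Scheme.IdealSheafData.support_comap] at hx'
      exact hx'
    exact Scheme.IdealSheafData.support_antitone hle this
  obtain ⟨ϖ, hϖ⟩ := IsDiscreteValuationRing.exists_irreducible O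
  obtain ⟨h, h𝓔h, hh2⟩ := exists_generator_not_mem_sq_of_isRegular_subscheme hX h𝓔reg h𝓔pr h𝓔0 (j x) hxmem
  rw [comap_strictTransformIdeal_host_eq_of_nestedSection O k θ hθ (σ ≫ q) j t hsq s hs' τ hτ υ j₂ hcomm x hx hυ hJ hsx (hX (j x)) ϖ hϖ 𝓔 hle
    h𝓔h hh2, h𝓔tr, strictTransformIdeal_vanishingIdeal_eq υ _ hυ]
  congr 1

end HostPointStep

end Summit.ResolutionOfSingularities.ResolutionOfSingularities.Cruxes.EquisingularLiftNat.Sections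

end
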